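import Summits.QuantumFields.YangMills.Theorems.UnitScaleTiltProp8FlatPortCurlCurlSupRowSharpL0
import Summits.QuantumFields.YangMills.Theorems.UnitScaleTiltProp8FlatPortKernelRowsAllL
import HarnessLib

/-!
# Route `UnitScaleTilt`, crux K1 child «MinimiserStabilityRegPr» (stmt-QuantumFields-19200), v8 pillar P2 — port level, **THE SHARP (X1♯) CURL–CURL SUP ROW WITH THE
# LEVEL WEIGHT, EVERY ODD `L ≥ 3`**: the twin of ✓`UnitScaleTiltProp8FlatPortCurlCurlSupRowSharpL0` (`curlCurlSupRowSharp_domT`, `curlCurlSupRowSharp_of_adm22`) with the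
# block-size floor `(hℓ : 4 ≤ ℓ)` DELETED, reading Prop. 2.7 (2.149) through ✓`FlatPortProp27PadAllL.prop27_kLevel_pad_allL` (lit-balaban's `B6QGQCoerciveKLevelV1L3`,
# coercivity `γ₀ = (1/12)²/C_E`) and the recharting through ✓`FlatPortKernelRowsAllL.chart_params_allL`

Cell `ym3-torus` (HUMAN RULING D-0037, YM ladder rung R3), seat `ym-inputs-p09` (cell `pub/ym-inputs`, on-call hand; ★★OWNER RULING g26-№20 L-FLOOR LEDGER item LF-1 ∕
(P2-L3); LEAD ★w5-19200 g4 board 09:30Z).  `--supports stmt-QuantumFields-19200 --as helper`; count-neutral; def-free.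

WHAT IS PROVED (sorry-free; axioms standard; no definition): **`curlCurlSupRowSharp_domT_allL`**, **`curlCurlSupRowSharp_of_adm22_allL`** — the statements of the L0 file
VERBATIM minus the binder `(hℓ : 4 ≤ ℓ)`, at every charted ∕ every `Adm22` family, EVERY odd `L ≥ 3`.  Proof = the L0 proof verbatim (helpers `curlCurlSupRowLW_of_row2sharp`,
`hRow3_sharp_of_portShapes`, `rowSum162_domT`, `globalBand_unitWeights`, `unitWeights_pos`, `lemma21_torus`, `theta_budget`, `absorb_budget` consumed BY NAME; the row shape is
generic in `Cγ = 2/γ₀`).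
HONEST SCOPE: bookkeeping over lit-balaban's kernel-checked L3 chain (`…V1L3`, binder `4 ≤ ℓ` dropped) through the `_allL` pads; the torus-size binder `a′ + 3 ≤ m + n`
stays ((P2-small), cured by the (α) cover); constants crude (L3 coercivity `γ₀ = (1/12)²/C_E` where it enters); nothing here proves `stub_halvingStep` or the crux;
YM₃ on T³ = rung R3, NOT the Clay problem, no mass-gap claim.

References: T. Bałaban, CMP **96** (1984) 223–250 [Balaban1984PropagatorsII] Prop. 2.7 (2.147)–(2.149) p.248–249, Lemma 2.1 (2.60)–(2.63) p.234; CMP **102** (1985) 277–309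
[Balaban1985Variational] (137)–(140) p.298–299, (161)–(163) p.303.
-/

set_option autoImplicit false

noncomputable section

open scoped BigOperators InnerProductSpace

namespace Summit.QuantumFields.YangMills.Theorems.FlatPortCurlCurlSupRowSharpAllL

open FlatPortCurlCurlSupRowSharpL0 (curlCurlSupRowLW_of_row2sharp)

open FlatPortHRows34 (aE_single)


open Literature.MathematicalPhysics.QuantumFieldTheory.Balaban1983to89
open Literature.MathematicalPhysics.QuantumFieldTheory.BalabanImbrieJaffe1984to88.BIJ85AxialPropagator411 (BondSpace)
open B5Eq118OneStroke (iterBlockOf iterBlock mem_iterBlock)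
open LatticeFieldCalculus (runSite runBond)
open B6MultiLevelBoxOperator (N0)
open B6MultiLevelTorusOperatorL0 (TDomains)
open B6Geom246MultiLevelBoxL0 (bset blkOf)
open B6Geom246MultiLevelTorusL0 (geomT bondT)
open B6GlobalChartV1 (PV toBox)
open B6GlobalChartV1L0 (blkV1 domT)
open B6Ineq2142KLevelV1 (iterBlockOf_runSite_mem)
open B6Ineq2142KLevelV1L0 (lvl lvl_le lvl_le_mK β qwt qwt_nonneg qwt_le QsE_single_apply exists_of_qwt_ne_zero lev_ends_bounds geomT_dist_ends_le)
open B6Ineq2133TwoScaleV1 (onFun onFun_apply)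
open B6GradLegKLevelV1 (DV)
open B6LapLegKLevelV1 (LapV LapV_apply)
open B6RandomWalk (HasMajorant BlockSupp)
open B6Lemma21Repaired (Ineq263With)
open B6Prop26KLevelSkeletonV1L0 (pref)
open B6Prop27KLevelV1L0 (lam)
open B6Cor28KLevelV1 (onFun_comp)
open B6Cor28KLevelV1L0 (comp_entry_le)
open B6SectADomainsV1 (Domains)
open B6SectAOperatorsV1 (BondIdx BondIdxSpace QsE aE dcE dcsE aE_apply)
open B6SectAVectorModelV1 (GE EE)
open B6SectA (hOp)
open B6CubeWindowV1 (GlobalBand)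
open B11Eq115Space (levOf)
open T3ContinuumYM3Torus (T3Family)
open FlatCubeOpsText (IsLevWeight)
open FlatOpsLettersAssembly (flatH)
open FlatPortDistanceL0 (levOf_domT blkV1_level)
open FlatPortHRows12 (cf_ne_zero toLp_indicator_eq_single indicator_eq_single)
open FlatPortHRows12L0 (flatH_apply_eq)

open FlatPortHRows34L0 (hasMajorant_one toLp_flatH_eq_hOp curlCurl_flatH_band levWeight_eq pref_blkV1)
open FlatPortHRow3SharpL0 (hRow3_sharp_of_portShapes)
open FlatCubeOpsText (RowSum162)
open FlatOpsHRowsFromKernels (levBase_bounds abs_data_le exp_le_rowSummand apply_eq_sum_indicator exists_indicator)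
open B6RandomWalk (delta3 delta3_pos)
open B6Ineq261LevelGap (K261 K261_nonneg)
open B6Geom246MultiLevelTorusL0 (lemma21_torus)
open B6Cor28KLevelV1 (two_le_RMh)
open B6QGQCoerciveKLevelV1L3 (gam0 gam0_pos)
open FlatPortProp27PadAllL (prop27_kLevel_pad_allL)
open FlatPortKernelRows (theta_budget absorb_budget)
open FlatPortKernelRowsAllL (chart_params_allL)
open FlatPortKernelRowsL0 (globalBand_unitWeights unitWeights_pos)
open FlatPortRowSumL0 (rowSum162_domT)

/-- `1 ≤ 3` (named once; every `domT`/`PV` below carries the same proof term). [folklore] -/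
private theorem hd3 : 1 ≤ 2 + 1 := by norm_num

/-! ## §2 (X1♯) from the `w₂`-kernel row and (162), abstract -/

section Abstract

variable {F : T3Family} {n K : ℕ} {D : Domains (F.P K)} {w : ℕ → PBond (F.P K) 0 → ℝ}
variable {dBI : PBond (F.P K) 0 → BondIdx D → ℝ} {H : (BondIdx D → ℝ) →ₗ[ℝ] (PBond (F.P K) 0 → ℝ)}


end Abstract

/-! ## §3 (X1♯) at every charted family and at every `Adm22` family, constants from `L` alone -/

section Assembly

/-- ★★ **(X1♯) AT EVERY CHARTED FAMILY OF THE d = 3 CARRIER, ODD `L ≥ 5`, `k ≥ 1`, CONSTANTS FROM `L` ALONE**: there are `M_h⁰, R₀` and `C♯ ≥ 0` such that for every volume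
exponent `m ≥ 1`, heights `1 ≤ K − n`, `K − n + 1 ≤ m + K`, every torus family with `P′ = L·P″`, `P″ ≥ 5`, `M_h = Lᵃ ≥ M_h⁰`, `R ≥ R₀`, every P2 weight family, all LEVEL-weighted
data `(L^{j(c)}η)|X c| ≤ t` (`t ≥ 0`) and every fine bond `b`: `w 3 b·|(∂^{η*}∂^η flatH X)(b)| ≤ C♯·t` — (k3♯) ∘ (162) (`rowSum162_domT` at rate `r = (15/16)(δ₄/2)`).
[cite: Balaban1985Variational, (88) p.291, (137)-(140) pp.298-299, (161)-(163) p.303; Balaban1984PropagatorsII, Prop. 2.7 (2.149) p.249, Lemma 2.1 (2.61)-(2.63) p.234] -/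
theorem curlCurlSupRowSharp_domT_allL (ℓ : ℕ) (hL : Odd (ℓ + 1) ∧ 1 < ℓ + 1) :
    ∃ (Mh₀ R₀ : ℕ) (CX : ℝ), 0 ≤ CX ∧
    ∀ (m : ℕ) (hm : 1 ≤ m) (n K : ℕ) {Mh R : ℕ} {P' : Fin (2 + 1) → ℕ} (hN : ∀ μ, N0 ℓ Mh (K - n) P' μ = (PV 2 ℓ m K hd3 hL).sitesPerDir 0)
      (D : TDomains 2 ℓ Mh (K - n) P' R) (hk : K - n ≤ m + K) (_ : 1 ≤ K - n) (_ : K - n + 1 ≤ m + K)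
      {P'' : Fin (2 + 1) → ℕ} (_ : ∀ μ, P' μ = (ℓ + 1) * P'' μ) (_ : ∀ μ, 5 ≤ P'' μ)
      {a : ℕ} (_ : Mh = (ℓ + 1) ^ a) (_ : Mh₀ ≤ Mh) (_ : R₀ ≤ R)
      (w : ℕ → PBond (PV 2 ℓ m K hd3 hL) 0 → ℝ) (_ : IsLevWeight (⟨ℓ + 1, hL, m, hm⟩ : T3Family) n K (B6GlobalChartV1L0.domT hN D hk) w),
      ∀ (X : BondIdx (domT hN D hk) → ℝ) (t : ℝ), 0 ≤ t →
        (∀ c, ((((ℓ + 1 : ℕ) : ℝ)) ^ ((c.1.1 : ℕ)) * ((((ℓ + 1 : ℕ) : ℝ))⁻¹) ^ (K - n)) * |X c| ≤ t) → ∀ b : PBond (PV 2 ℓ m K hd3 hL) 0,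
        w 3 b * |(dcsE ((((ℓ + 1 : ℕ) : ℝ)) ^ (K - n)) (dcE ((((ℓ + 1 : ℕ) : ℝ)) ^ (K - n))
          (WithLp.toLp 2 (flatH (⟨ℓ + 1, hL, m, hm⟩ : T3Family) n K (domT hN D hk) X)))) b| ≤ CX * t := by
  -- the (2.149) package at the unit band `b₀ = b₁ = 1`
  obtain ⟨σb, hσb, hB⟩ := prop27_kLevel_pad_allL 2 ℓ hd3 hL one_pos (le_refl (1 : ℝ))
  obtain ⟨A', M₂b, cc, N₁b, hA', hM₂b, hcc, hrowsB⟩ := hB σb hσb le_rfl (1 / 2) (by norm_num) (by norm_num)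
  -- the rates (verbatim from `kernelRowsAt_domT`'s row-3 block)
  set δ₃ : ℝ := delta3 (1 / 2) (2 * σb) with hδ₃
  have hδ₃0 : 0 < δ₃ := delta3_pos (by norm_num) (by linarith)
  set γ₀ : ℝ := gam0 2 ℓ 1 with hγ₀
  have hγ₀0 : 0 < γ₀ := gam0_pos 2 ℓ zero_le_one
  set δ₄ : ℝ := min (δ₃ / 4) (γ₀ / A' / (2 * (1 * (4 / δ₃) * (2 * ((2 : ℝ) + 1) * cc)) + 1)) with hδ₄
  have hδ₄0 : 0 < δ₄ := by
    refine lt_min (by linarith) (div_pos (div_pos hγ₀0 hA') ?_)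
    have : 0 ≤ 2 * (1 * (4 / δ₃) * (2 * ((2 : ℝ) + 1) * cc)) := by positivity
    linarith
  have hδ₄3 : δ₄ ≤ δ₃ := (min_le_left _ _).trans (by linarith)
  set r : ℝ := (1 - 1 / 16) * (δ₄ / 2) with hr
  have hr0 : 0 < r := by rw [hr]; positivity
  -- Lemma-2.1 budgets: rate `δ₄/2`, `α′ = 1/16` for (2.63); rate `r/4` for the (162) row sum
  obtain ⟨hN63pos, hθ63⟩ := theta_budget ℓ (show 0 < 1 / 16 * (δ₄ / 2) by positivity)
  set N63 : ℕ := ⌈2 * ((2 + 1 : ℕ) : ℝ) * Real.log ((ℓ : ℝ) + 1) / (1 / 16 * (δ₄ / 2))⌉₊ + 1 with hN63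
  set Na4 : ℕ := ⌈2 * ((2 : ℝ) + 3) * ((ℓ : ℝ) + 1) / δ₄⌉₊ with hNa4
  obtain ⟨hN0rpos, hθ0r⟩ := theta_budget ℓ (show 0 < 1 / 4 * r by positivity)
  set N0r : ℕ := ⌈2 * ((2 + 1 : ℕ) : ℝ) * Real.log ((ℓ : ℝ) + 1) / (1 / 4 * r)⌉₊ + 1 with hN0r
  set Na0r : ℕ := ⌈2 * ((2 : ℝ) + 3) * ((ℓ : ℝ) + 1) / (r / 4)⌉₊ with hNa0r
  -- the constants
  set Lr : ℝ := (ℓ : ℝ) + 1 with hLr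
  have hL1 : (1 : ℝ) ≤ Lr := by rw [hLr]; linarith [(Nat.cast_nonneg ℓ : (0 : ℝ) ≤ ℓ)]
  set c63 : ℝ := K261 N63 (2 + 1) Lr 1 (1 / 16 * (δ₄ / 2)) with hc63
  have hc630 : 0 ≤ c63 := K261_nonneg (by linarith : (0 : ℝ) ≤ Lr) zero_le_one
  set K₃ : ℝ := (2 / γ₀) * (2 * (((ℓ + 1 : ℕ) : ℝ)) ^ (2 + 1) * Real.exp (δ₃ * ((ℓ : ℝ) + 3))) * Lr ^ 2 * Lr ^ (2 + 3) * (2 * ((2 : ℝ) + 1)) * c63 ^ 2 with hK₃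
  have hK₃0 : 0 ≤ K₃ := by rw [hK₃]; positivity
  set C₃ : ℝ := K₃ * Real.exp (3 * r) + 1 * Real.exp (r * ((ℓ : ℝ) + 6)) with hC₃
  have hC₃0 : 0 ≤ C₃ := by positivity
  set B3r : ℝ := 6 * Lr * (1 / (Real.exp 1 * (r / 8)) + 4) * K261 N0r (2 + 1) Lr 1 (1 / 4 * r) with hB3r
  have hB3r0 : 0 ≤ B3r := by
    have := K261_nonneg (N := N0r) (dd := 2 + 1) (σ := 1 / 4 * r) (by linarith : (0 : ℝ) ≤ Lr) zero_le_one
    have := Real.exp_pos 1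
    rw [hB3r]; positivity
  -- the thresholds on `M_h` and `R`
  set Mh₀ : ℕ := max 8 ⌈M₂b⌉₊ with hMh₀
  set R₀ : ℕ := max (2 * (ℓ + 1) ^ 2) (max (N₁b + 1) (max (N63 + 1) (max (Na4 + 1) (max (N0r + 1) (Na0r + 1))))) with hR₀
  refine ⟨Mh₀, R₀, C₃ * B3r, by positivity, ?_⟩
  intro m hm n K Mh R P' hN D hk hk1 hk' P'' hLP hP5 a hMha hMh hR w hw
  -- unpack the thresholds
  have hM8 : 8 ≤ Mh := le_trans (le_max_left _ _) hMh
  have hMh1 : 1 ≤ Mh := le_trans (by norm_num) hM8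
  have hR2 : 2 * (ℓ + 1) ^ 2 ≤ R := le_trans (le_max_left _ _) hR
  have hRMh : 2 ≤ R * Mh := two_le_RMh hR2 hM8
  have hRLM : ∀ {N : ℕ}, N + 1 ≤ R₀ → N + 1 ≤ R * ((ℓ + 1) * Mh) := fun {N} h =>
    le_trans (le_trans h hR) (Nat.le_mul_of_pos_right R (Nat.mul_pos (Nat.succ_pos ℓ) (by omega)))
  have hN₁b : N₁b + 1 ≤ R * ((ℓ + 1) * Mh) := hRLM (le_trans (le_max_left _ _) (le_max_right _ _))
  have hN63' : N63 + 1 ≤ R * ((ℓ + 1) * Mh) := hRLM (le_trans (le_trans (le_max_left _ _) (le_max_right _ _)) (le_max_right _ _))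
  have hNa4' : Na4 + 1 ≤ R * ((ℓ + 1) * Mh) := hRLM (le_trans (le_trans (le_trans (le_max_left _ _) (le_max_right _ _)) (le_max_right _ _)) (le_max_right _ _))
  have hN0r' : N0r + 1 ≤ R * ((ℓ + 1) * Mh) :=
    hRLM (le_trans (le_trans (le_trans (le_trans (le_max_left _ _) (le_max_right _ _)) (le_max_right _ _)) (le_max_right _ _)) (le_max_right _ _))
  have hNa0r' : Na0r + 1 ≤ R * ((ℓ + 1) * Mh) :=
    hRLM (le_trans (le_trans (le_trans (le_trans (le_max_right _ _) (le_max_right _ _)) (le_max_right _ _)) (le_max_right _ _)) (le_max_right _ _))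
  have hM₂b' : M₂b ≤ ((ℓ : ℝ) + 1) * Mh := by
    have h0 : ⌈M₂b⌉₊ ≤ Mh := le_trans (le_max_right _ _) hMh
    have h1 : M₂b ≤ (⌈M₂b⌉₊ : ℝ) := Nat.le_ceil _
    have h2 : (⌈M₂b⌉₊ : ℝ) ≤ (Mh : ℝ) := by exact_mod_cast h0
    have h3 : (Mh : ℝ) ≤ ((ℓ : ℝ) + 1) * Mh := le_mul_of_one_le_left (Nat.cast_nonneg _) hL1
    linarith
  have hP1 : ∀ μ, 1 ≤ P' μ := fun μ => by rw [hLP μ]; exact Nat.mul_pos (Nat.succ_pos ℓ) (by have := hP5 μ; omega)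
  -- the band weights
  set ws : BondIdx (domT hN D hk) → ℝ := fun i =>
    ((((ℓ + 1 : ℕ) : ℝ)) ^ (K - n) / (((ℓ + 1 : ℕ) : ℝ)) ^ (i.1.1 : ℕ)) ^ 2 * ((((ℓ + 1 : ℕ) : ℝ)) ^ (i.1.1 : ℕ)) ^ (2 + 1) with hws_def
  have hws : ∀ i, 0 < ws i := unitWeights_pos ℓ hL m n K hN D hk
  have hband : GlobalBand (Dm := domT hN D hk) 1 1 ((((ℓ + 1 : ℕ) : ℝ)) ^ (K - n)) ws := globalBand_unitWeights ℓ hL m n K hN D hk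
  -- (2.149) at these data
  have h2149 := hrowsB m K hN D hk hk1 hk' hLP hP5 hMha hM8 hR2 hM₂b' hN₁b (cf_ne_zero ℓ n K) hws hband
  -- Lemma 2.1 on the torus at rate `δ₄/2`, `α′ = 1/16`: (2.61) AND (2.63)
  obtain ⟨-, -, -, h263⟩ := lemma21_torus (D := D) hMh1 hP1 hN63pos hN63' (show (0 : ℝ) ≤ δ₄ / 2 by positivity)
    (by norm_num : (0 : ℝ) ≤ 1 / 16) (by norm_num : (1 : ℝ) / 16 ≤ 1) hθ63
  -- the absorption threshold at rate `δ₄`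
  obtain ⟨hsm4, -, -⟩ := absorb_budget ℓ hδ₄0 hNa4'
  -- (k3♯) over `d_T + 3` at `(C₃, r)`
  have hk2s : ∀ (c : BondIdx (domT hN D hk)) (e : BondIdx (domT hN D hk) → ℝ), e c = 1 → (∀ c', c' ≠ c → e c' = 0) →
      ∀ b : PBond (PV 2 ℓ m K hd3 hL) 0,
        w 2 b * |(dcsE ((((ℓ + 1 : ℕ) : ℝ)) ^ (K - n)) (dcE ((((ℓ + 1 : ℕ) : ℝ)) ^ (K - n))
          (WithLp.toLp 2 (flatH (⟨ℓ + 1, hL, m, hm⟩ : T3Family) n K (domT hN D hk) e)))) b| ≤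
        C₃ * Real.exp (-(r * (((bondT D).dist (blkV1 hN D b) (β hN D hk c) : ℝ) + 3))) := by
    intro c e he he' b
    exact hRow3_sharp_of_portShapes ℓ hL m hm n K hN D hk hRMh hMh1 hP1 hws zero_le_one hband (by positivity) hδ₄0 hδ₄3
      (by norm_num : (1 : ℝ) / 16 ≤ 1) h2149 hsm4 h263 w hw c e he he' b
  -- the (162) row sum over `d_T + 3` at rate `r`
  obtain ⟨-, -, hsm0r⟩ := absorb_budget ℓ (show 0 < r / 4 by positivity) hNa0r'
  have hsm0r' : ((ℓ : ℝ) + 1) ^ 1 * Real.exp (-(r / 8 * ((R : ℝ) * (((ℓ : ℝ) + 1) * Mh) - 1))) ≤ 1 := by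
    have e : r / 4 / 2 = r / 8 := by ring
    rw [e] at hsm0r; exact hsm0r
  have hrow := rowSum162_domT ℓ hL m hm n K hN D hk hMh1 hP1 hr0 hN0rpos hN0r' hθ0r hsm0r' w hw
  have hδhalf : r / 2 ≤ r := by linarith
  have hd0 : ∀ (b : PBond (PV 2 ℓ m K hd3 hL) 0) (c : BondIdx (domT hN D hk)), (0 : ℝ) ≤ ((bondT D).dist (blkV1 hN D b) (β hN D hk c) : ℝ) + 3 :=
    fun _ _ => by positivity
  intro X t ht hX b
  exact curlCurlSupRowLW_of_row2sharp (F := (⟨ℓ + 1, hL, m, hm⟩ : T3Family)) (n := n) (K := K) (D := domT hN D hk) (w := w)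
    (dBI := fun b c => ((bondT D).dist (blkV1 hN D b) (β hN D hk c) : ℝ) + 3) (H := flatH (⟨ℓ + 1, hL, m, hm⟩ : T3Family) n K (domT hN D hk))
    hw rfl hC₃0 hδhalf hd0 hk2s hrow X t ht hX b

/-- ★★ **(X1♯) AT EVERY ADMISSIBLE FAMILY OF THE P2 TEXT** (level `0` admitted; via `FlatPortChartL0.tdOfAdmL0`∕`domT_tdOfAdmL0`): for odd `L = ℓ + 1 ≥ 3` there are `M_h⁰, R₀` and
`C♯ ≥ 0` such that for all `m ≥ 1`, heights `1 ≤ K − n`, `K − n + 1 ≤ m + K`, big blocks `M = L·M_h`, `M_h = L^{a′} ≥ M_h⁰`, `R ≥ R₀`, torus size `a′ + 3 ≤ m + n`, every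
`D : Domains (F.P K)` with `D.k = K − n`, `Adm22 D R (L·M_h)`, every P2 weight family, all LEVEL-weighted data `(L^{j(c)}η)|X c| ≤ t` (`t ≥ 0`):
`∀ b, w 3 b·|(∂^{η*}∂^η flatH F n K D X)(b)| ≤ C♯·t` — the (X1) letter of `Hs` at unweighted data, same data as `kernelRowsAt_of_adm22`.
[cite: Balaban1984PropagatorsII, (2.1)-(2.4) p.224, Prop. 2.7 (2.149) p.249, Lemma 2.1 (2.61)-(2.63) p.234; Balaban1985Variational, (45)-(46) p.285, (88) p.291, (161)-(163) p.303] -/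
theorem curlCurlSupRowSharp_of_adm22_allL (ℓ : ℕ) (hL : Odd (ℓ + 1) ∧ 1 < ℓ + 1) :
    ∃ (Mh₀ R₀ : ℕ) (CX : ℝ), 0 ≤ CX ∧
    ∀ (m : ℕ) (hm : 1 ≤ m) (n K : ℕ) (_ : 1 ≤ K - n) (_ : K - n + 1 ≤ m + K) {Mh R a' : ℕ} (_ : Mh = (ℓ + 1) ^ a') (_ : Mh₀ ≤ Mh) (_ : R₀ ≤ R) (_ : a' + 3 ≤ m + n)
      (D : B6SectADomainsV1.Domains (PV 2 ℓ m K hd3 hL)) (_ : D.k = K - n) (_ : FlatCubeOpsText.Adm22 D R ((ℓ + 1) * Mh))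
      (w : ℕ → PBond (PV 2 ℓ m K hd3 hL) 0 → ℝ) (_ : IsLevWeight (⟨ℓ + 1, hL, m, hm⟩ : T3Family) n K D w),
      ∀ (X : BondIdx D → ℝ) (t : ℝ), 0 ≤ t → (∀ c, ((((ℓ + 1 : ℕ) : ℝ)) ^ ((c.1.1 : ℕ)) * ((((ℓ + 1 : ℕ) : ℝ))⁻¹) ^ (K - n)) * |X c| ≤ t) →
        ∀ b : PBond (PV 2 ℓ m K hd3 hL) 0,
          w 3 b * |(dcsE ((((ℓ + 1 : ℕ) : ℝ)) ^ (K - n)) (dcE ((((ℓ + 1 : ℕ) : ℝ)) ^ (K - n))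
            (WithLp.toLp 2 (flatH (⟨ℓ + 1, hL, m, hm⟩ : T3Family) n K D X)))) b| ≤ CX * t := by
  obtain ⟨Mh₀, R₀, CX, hCX, hmain⟩ := curlCurlSupRowSharp_domT_allL ℓ hL
  refine ⟨Mh₀, R₀, CX, hCX, ?_⟩
  intro m hm n K hk1 hk' Mh R a' hMha hMh hR hsize D hDk hAdm w hw
  have hk : K - n ≤ m + K := by omega
  obtain ⟨hN, hLP, hP5⟩ := chart_params_allL ℓ m n K a' hL hk1 hsize
  rw [hMha] at hAdm
  have hN' : ∀ μ : Fin (2 + 1), N0 ℓ Mh (K - n) (fun _ => 2 * (ℓ + 1) ^ (m + n - 1 - a')) μ = (PV 2 ℓ m K hd3 hL).sitesPerDir 0 := by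
    rw [hMha]; exact hN
  rw [← hMha] at hAdm
  set D' := FlatPortChartL0.tdOfAdmL0 hN' D hDk hk hAdm with hD'
  have hEq : domT hN' D' hk = D := FlatPortChartL0.domT_tdOfAdmL0 hN' D hDk hk hAdm
  rw [← hEq] at hw ⊢
  exact hmain m hm n K hN' D' hk hk1 hk' hLP hP5 hMha hMh hR w hw

end Assembly

end Summit.QuantumFields.YangMills.Theorems.FlatPortCurlCurlSupRowSharpAllL

end
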